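import Summits.HodgeConjecture.HodgeConjecture.Theorems.R90S2ArchOrbitalProductTie   -- ★ `archProjAt` (projections along ★ `archPiEquivCM` as monoid homs), `IsOrbitalProductAt`, the S2 vocabulary
import HarnessLib

/-!
# R90-TF ∕ S2 «Ch. 12 archimedean block» — `R90S2ArchOrbitalProductOfWeilForm`: the ALL-PLACES orbital product on `G_∞ = U(H)(L ⊗ ℝ) ≃ ∏_w U(σ_w H)(ℂ)`
# for PURE TENSORS, FILE 1 (the closed binder `IsArchProductFamily` + its hypothesis-first consequences)

Cell `pub/hodgecm-mathlib`, HCML Track R90-TF, section S2 (base `R90-C11`), crux h413 = `stmt-HodgeConjecture-24833`, route of record `HCCMUnconditional`;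
prover seat LH7-p07 (g2) on the chair's ACROSS-LINES VALVE 12 (a) (2026-09-05T01:42:46Z; S2 dealer K2E1b-plan (g8) `PAYMENT-ROADS-S2.v1` §2 (3)); lane
`--supports stmt-HodgeConjecture-24833 --as helper` (count-neutral; `--kind definition` for the ONE closed `Prop`).  Conventions of ★ `R90S2ArchOrbitalProductTie`:
no socket, no instance, no notation, no `sorry`, default heartbeats.

## WHAT
★ `R90S2ArchOrbitalProductTie.IsOrbitalProductAt H τc m mτ mc` is the ONE-PLACE (local ⊗ away) product tie for class orbital integrals on `G_∞`, Fubini-as-hypothesis in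
kit-law style.  THIS FILE is its ALL-PLACES companion for PURE TENSORS `f = ⊗_w φ_w`, i.e. `f g = ∏_w φ_w ((archPiEquivCM g)_w)` (★ CARD 2 `R90S2ArchPureTensor.archTensor`'s
read-back; here HYPOTHESIS-FIRST as `hf`, so nothing waits on CARD 2):
* `IsArchProductFamily H P m mloc` (+ `_iff`, `.mono`) — the CLOSED named `Prop`, GUARDED by a predicate `P` on `G_∞` (S2 desk 01:49:35Z: the global family of
  record is constrained only at REGULAR classes — consumers take `P := fun γ => IsRegularElt γ.val`; `P := fun _ => True` is the all-classes case): for the global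
  orbital-measure family `m` on `G_∞` and local families `mloc w` on the `U(σ_w H)(ℂ)`, the class orbital integral at `ConjClasses.mk γ`, `P γ`, of every pure tensor is the
  product over the complex places of the local class orbital integrals at the projected classes
  `ConjClasses.map (archProjAt H w) c` (Rogawski §5.4 `Φ(γ, f) = ∏_v Φ(γ_v, f_v)` at the archimedean places; Gelbart (9.14)).  A BINDER (J-S2-11 ↔ E1 style: whoever
  constructs the kit families pays it) — see «FILE 2» below for its measure-level discharge; it is NOT a socket.
* `orbitalIntegral_archTensor_eq_prod` — under the binder, the product formula for ANY `f` with a pure-tensor read-back `hf` (the `hprod` conclusion bytes of K2E4-p23 (g4)'s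
  stable twin `R90S2ArchStableOrbitalProduct`).
* `classOrbitalIntegral_archTensor_eq_zero_of_place` — vanishing of ONE local class orbital integral kills the global one (print p. 218 L20–21, unstable form).
* `orbitalIntegral_archTensor_update_eq` — replacing the factor at ONE place `u`: `O(⊗ (update φ u ψ)) = O_u(ψ) · ∏_{w ≠ u} O_w(φ_w)`; hence
  `orbitalIntegral_archTensor_update_congr` — two pure tensors differing at `u` only, with equal local class orbital integrals at `u`, have equal global class orbital
  integrals (print's `f = (f_{1u} − f_{2u}) ⊗ ⊗_{w≠u} f_w` step WITHOUT subtraction, so no integrability is needed).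

## FILE 2 (the E-grade discharge, 6–9 h, NOT in this file — honest)
`isArchProductFamily_of_map_pi`: if for every class `c` the measure `m c` on `G_∞ ⧸ C(out c)` is the push-forward, along the coset-product equivalence
`G_∞ ⧸ C(γ) ≃ ∏_w (U(σ_w H)(ℂ) ⧸ C(γ_w))` induced by ★ `archPiEquivCM` (the plain-`Π` twin of ★ `RestrictedProduct/OrbitalEulerProduct`'s `quotientHomeomorph`;
`C(γ) ↔ ∏_w C(γ_w)` as in ★ `mem_centralizer_singleton_iff_forall_mem`), of `Measure.pi (fun w => (mloc w).atPoint γ_w)` (★ `OrbitalMeasureFamily.atPoint` for the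
representative book-keeping `out (c_w)` vs `(archPiEquivCM (out c)) w`), then `IsArchProductFamily H m mloc` — by the plain-`Π` twin of ★ `forall_descConj_mk_eq_prod`, Mathlib
`MeasureTheory.integral_fintype_prod_eq_prod` and ★ `integral_descConj_map_cosetCongr` (exact, no constant).  Not typed here (seat wall); the binder is stated so that FILE 2
proves it verbatim.

HONEST LABEL: a closed binder and hypothesis-to-conclusion lemmas; NO Fubini is paid in this file; HC_CM is proved only modulo the 7 printed citations (2 remaining named inputs:
hLiu418 = `stmt-HodgeConjecture-24832`, h413 = `stmt-HodgeConjecture-24833`) until rung 0 closes.  Count-neutral.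

References: [Rogawski1990] §5.4 p. 72, §14.4; [Gelbart1975] (9.13)–(9.14); [BorelJacquet1979] §4.1 (factorizable functions); [Arthur1988InvariantTraceFormulaII] §7.
-/

set_option autoImplicit false
set_option linter.dupNamespace false

noncomputable section

open MeasureTheory NumberField NumberField.InfinitePlace CompactlySupported
open scoped Matrix MatrixGroups Classical  -- `Classical`: the `Fintype` ∕ `DecidableEq` of the complex places (as ★ `ArchSingularOrbitalIntegralProductPlaces`)
open Literature.NumberTheory.Automorphic Literature.NumberTheory.Automorphic.UnitaryGroup

namespace Summit.HodgeConjecture.HodgeConjecture.R90.S2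

/-! ## The all-places product binder for pure tensors and its consequences -/

section ArchProduct

variable {L : Type} [Field L] [NumberField L] [IsCMField L] {N : ℕ} (H : Matrix (Fin N) (Fin N) L)

/-- **THE ALL-PLACES ORBITAL PRODUCT TIE FOR PURE TENSORS on `G_∞ = U(H)(L ⊗ ℝ) ≃ ∏_w U(σ_w H)(ℂ)`** (Fubini-as-hypothesis, kit-law style as ★ `IsOrbitalProductAt`):
the global orbital-measure family `m` and the local families `mloc w` are PRODUCT-COMPATIBLE ON THE CLASSES OF THE `P`-ELEMENTS (guard `P`: the families of record are
constrained at regular classes only) if the class orbital integral of every pure tensor `g ↦ ∏_w φ_w ((archPiEquivCM g)_w)` at the class of every `γ` with `P γ` is the product over the complex places `w` of the local class orbital integrals of the factors `φ_w` at the projected classes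
`ConjClasses.map (archProjAt H w) c`.  A BINDER for the E1∕(U) road (its measure-level discharge is FILE 2, see the module docstring); NOT a socket.
[cite: Rogawski1990, §5.4 p. 72] [cite: Gelbart1975, (9.14)] [cite: BorelJacquet1979, §4.1] -/
def IsArchProductFamily
    [∀ γ : ↥(arch (↥(maximalRealSubfield L)) L (IsCMField.complexConj L) N H),
      MeasurableSpace (↥(arch (↥(maximalRealSubfield L)) L (IsCMField.complexConj L) N H) ⧸ Subgroup.centralizer ({γ} : Set _))]
    [∀ (w : {w : InfinitePlace L // w.IsComplex}) (γ : ↥(archLocal L N H w)),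
      MeasurableSpace (↥(archLocal L N H w) ⧸ Subgroup.centralizer ({γ} : Set ↥(archLocal L N H w)))]
    (P : ↥(arch (↥(maximalRealSubfield L)) L (IsCMField.complexConj L) N H) → Prop)
    (m : OrbitalMeasureFamily ↥(arch (↥(maximalRealSubfield L)) L (IsCMField.complexConj L) N H))
    (mloc : ∀ w : {w : InfinitePlace L // w.IsComplex}, OrbitalMeasureFamily ↥(archLocal L N H w)) : Prop :=
  ∀ (φ : ∀ w : {w : InfinitePlace L // w.IsComplex}, ↥(archLocal L N H w) → ℂ)
    (γ : ↥(arch (↥(maximalRealSubfield L)) L (IsCMField.complexConj L) N H)), P γ →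
    classOrbitalIntegral m (fun g => ∏ w, φ w (archPiEquivCM L H (N := N) g w)) (ConjClasses.mk γ) =
      ∏ w, classOrbitalIntegral (mloc w) (φ w) (ConjClasses.map (archProjAt H w) (ConjClasses.mk γ))

/-- Unfolding of `IsArchProductFamily` (definitional). [cite: Rogawski1990, §5.4 p. 72] -/
theorem isArchProductFamily_iff
    [∀ γ : ↥(arch (↥(maximalRealSubfield L)) L (IsCMField.complexConj L) N H),
      MeasurableSpace (↥(arch (↥(maximalRealSubfield L)) L (IsCMField.complexConj L) N H) ⧸ Subgroup.centralizer ({γ} : Set _))]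
    [∀ (w : {w : InfinitePlace L // w.IsComplex}) (γ : ↥(archLocal L N H w)),
      MeasurableSpace (↥(archLocal L N H w) ⧸ Subgroup.centralizer ({γ} : Set ↥(archLocal L N H w)))]
    (P : ↥(arch (↥(maximalRealSubfield L)) L (IsCMField.complexConj L) N H) → Prop)
    (m : OrbitalMeasureFamily ↥(arch (↥(maximalRealSubfield L)) L (IsCMField.complexConj L) N H))
    (mloc : ∀ w : {w : InfinitePlace L // w.IsComplex}, OrbitalMeasureFamily ↥(archLocal L N H w)) :
    IsArchProductFamily H P m mloc ↔
      ∀ (φ : ∀ w : {w : InfinitePlace L // w.IsComplex}, ↥(archLocal L N H w) → ℂ)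
        (γ : ↥(arch (↥(maximalRealSubfield L)) L (IsCMField.complexConj L) N H)), P γ →
        classOrbitalIntegral m (fun g => ∏ w, φ w (archPiEquivCM L H (N := N) g w)) (ConjClasses.mk γ) =
          ∏ w, classOrbitalIntegral (mloc w) (φ w) (ConjClasses.map (archProjAt H w) (ConjClasses.mk γ)) :=
  Iff.rfl

variable
    [∀ γ : ↥(arch (↥(maximalRealSubfield L)) L (IsCMField.complexConj L) N H),
      MeasurableSpace (↥(arch (↥(maximalRealSubfield L)) L (IsCMField.complexConj L) N H) ⧸ Subgroup.centralizer ({γ} : Set _))]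
    [∀ (w : {w : InfinitePlace L // w.IsComplex}) (γ : ↥(archLocal L N H w)),
      MeasurableSpace (↥(archLocal L N H w) ⧸ Subgroup.centralizer ({γ} : Set ↥(archLocal L N H w)))]
    {P : ↥(arch (↥(maximalRealSubfield L)) L (IsCMField.complexConj L) N H) → Prop}
    {m : OrbitalMeasureFamily ↥(arch (↥(maximalRealSubfield L)) L (IsCMField.complexConj L) N H)}
    {mloc : ∀ w : {w : InfinitePlace L // w.IsComplex}, OrbitalMeasureFamily ↥(archLocal L N H w)}

/-- the guard is contravariant: a tie on the classes of `P`-elements is a tie on the classes of `Q`-elements whenever `Q ⇒ P`. [folklore] -/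
theorem IsArchProductFamily.mono {Q : ↥(arch (↥(maximalRealSubfield L)) L (IsCMField.complexConj L) N H) → Prop} (hPQ : ∀ γ, Q γ → P γ)
    (h : IsArchProductFamily H P m mloc) : IsArchProductFamily H Q m mloc :=
  fun φ γ hγ => h φ γ (hPQ γ hγ)

/-- **THE PRODUCT FORMULA FOR A PURE TENSOR** `Φ(γ, ⊗_w φ_w) = ∏_w Φ(γ_w, φ_w)` under the all-places tie: for ANY test function `f` on `G_∞` with a pure-tensor read-back
`hf : f g = ∏_w φ_w ((archPiEquivCM g)_w)` (★ CARD 2 `archTensor_apply`'s shape, hypothesis-first), the class orbital integral of `f` at `c` is the product of the local class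
orbital integrals at the projected classes.  (The `hprod` conclusion bytes of the stable twin `R90S2ArchStableOrbitalProduct`.) [cite: Rogawski1990, §5.4 p. 72]
[cite: Gelbart1975, (9.14)] -/
theorem orbitalIntegral_archTensor_eq_prod (hm : IsArchProductFamily H P m mloc)
    {f : ↥(arch (↥(maximalRealSubfield L)) L (IsCMField.complexConj L) N H) → ℂ} {φ : ∀ w : {w : InfinitePlace L // w.IsComplex}, ↥(archLocal L N H w) → ℂ}
    (hf : ∀ g, f g = ∏ w, φ w (archPiEquivCM L H (N := N) g w))
    (γ : ↥(arch (↥(maximalRealSubfield L)) L (IsCMField.complexConj L) N H)) (hγ : P γ) :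
    classOrbitalIntegral m f (ConjClasses.mk γ) = ∏ w, classOrbitalIntegral (mloc w) (φ w) (ConjClasses.map (archProjAt H w) (ConjClasses.mk γ)) := by
  have hfe : f = fun g => ∏ w, φ w (archPiEquivCM L H (N := N) g w) := funext hf
  rw [hfe]
  exact hm φ γ hγ

/-- **VANISHING AT ONE PLACE KILLS THE PRODUCT** (print p. 218 L20–21, unstable form): if the local class orbital integral of the factor `φ_{w₀}` vanishes at the projected class,
the global class orbital integral of the pure tensor vanishes. [cite: Rogawski1990, §13.8 p. 218] [cite: Rogawski1990, §5.4 p. 72] -/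
theorem classOrbitalIntegral_archTensor_eq_zero_of_place (hm : IsArchProductFamily H P m mloc)
    {f : ↥(arch (↥(maximalRealSubfield L)) L (IsCMField.complexConj L) N H) → ℂ} {φ : ∀ w : {w : InfinitePlace L // w.IsComplex}, ↥(archLocal L N H w) → ℂ}
    (hf : ∀ g, f g = ∏ w, φ w (archPiEquivCM L H (N := N) g w))
    (γ : ↥(arch (↥(maximalRealSubfield L)) L (IsCMField.complexConj L) N H)) (hγ : P γ) (w₀ : {w : InfinitePlace L // w.IsComplex})
    (h0 : classOrbitalIntegral (mloc w₀) (φ w₀) (ConjClasses.map (archProjAt H w₀) (ConjClasses.mk γ)) = 0) :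
    classOrbitalIntegral m f (ConjClasses.mk γ) = 0 := by
  rw [orbitalIntegral_archTensor_eq_prod H hm hf γ hγ]
  exact Finset.prod_eq_zero (Finset.mem_univ w₀) h0

/-- **REPLACING THE FACTOR AT ONE PLACE**: for the pure tensor with factors `Function.update φ u ψ` (the factor at `u` replaced by `ψ`), the global class orbital integral is
`O_u(ψ) · ∏_{w ≠ u} O_w(φ_w)` at the projected classes. [cite: Rogawski1990, §5.4 p. 72] [cite: BorelJacquet1979, §4.1] -/
theorem orbitalIntegral_archTensor_update_eq (hm : IsArchProductFamily H P m mloc)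
    (φ : ∀ w : {w : InfinitePlace L // w.IsComplex}, ↥(archLocal L N H w) → ℂ) (u : {w : InfinitePlace L // w.IsComplex}) (ψ : ↥(archLocal L N H u) → ℂ)
    (γ : ↥(arch (↥(maximalRealSubfield L)) L (IsCMField.complexConj L) N H)) (hγ : P γ) :
    classOrbitalIntegral m (fun g => ∏ w, Function.update φ u ψ w (archPiEquivCM L H (N := N) g w)) (ConjClasses.mk γ) =
      classOrbitalIntegral (mloc u) ψ (ConjClasses.map (archProjAt H u) (ConjClasses.mk γ)) *
        ∏ w ∈ Finset.univ.erase u, classOrbitalIntegral (mloc w) (φ w) (ConjClasses.map (archProjAt H w) (ConjClasses.mk γ)) := by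
  rw [hm (Function.update φ u ψ) γ hγ, ← Finset.mul_prod_erase Finset.univ _ (Finset.mem_univ u), Function.update_self]
  congr 1
  exact Finset.prod_congr rfl fun w hw => by rw [Function.update_of_ne (Finset.ne_of_mem_erase hw)]

/-- **TWO PURE TENSORS DIFFERING AT ONE PLACE**: if the local class orbital integrals of `ψ₁` and `ψ₂` at the projected class agree at the place `u`, the pure tensors
`⊗ (update φ u ψ₁)` and `⊗ (update φ u ψ₂)` have the same global class orbital integral at `c` (print's `f = (f_{1u} − f_{2u}) ⊗ ⊗_{w≠u} f_w` step, §13.8 p. 218, stated without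
subtraction so that no integrability is needed). [cite: Rogawski1990, §13.8 p. 218] [cite: Rogawski1990, §5.4 p. 72] -/
theorem orbitalIntegral_archTensor_update_congr (hm : IsArchProductFamily H P m mloc)
    (φ : ∀ w : {w : InfinitePlace L // w.IsComplex}, ↥(archLocal L N H w) → ℂ) (u : {w : InfinitePlace L // w.IsComplex}) (ψ₁ ψ₂ : ↥(archLocal L N H u) → ℂ)
    (γ : ↥(arch (↥(maximalRealSubfield L)) L (IsCMField.complexConj L) N H)) (hγ : P γ)
    (h : classOrbitalIntegral (mloc u) ψ₁ (ConjClasses.map (archProjAt H u) (ConjClasses.mk γ)) =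
      classOrbitalIntegral (mloc u) ψ₂ (ConjClasses.map (archProjAt H u) (ConjClasses.mk γ))) :
    classOrbitalIntegral m (fun g => ∏ w, Function.update φ u ψ₁ w (archPiEquivCM L H (N := N) g w)) (ConjClasses.mk γ) =
      classOrbitalIntegral m (fun g => ∏ w, Function.update φ u ψ₂ w (archPiEquivCM L H (N := N) g w)) (ConjClasses.mk γ) := by
  rw [orbitalIntegral_archTensor_update_eq H hm φ u ψ₁ γ hγ, orbitalIntegral_archTensor_update_eq H hm φ u ψ₂ γ hγ, h]

/-- **THE ALL-PLACES TIE GIVES THE VANISHING HALF OF THE ONE-PLACE ARCHITECTURE (B)** without the away family: under `IsArchProductFamily`, a pure tensor whose factor at `u`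
has vanishing local class orbital integral at EVERY class of `U(σ_u H)(ℂ)` whose representative is regular non-elliptic (a factor CUSPIDAL at `u` in the sense of ★
`IsLocCuspidal`'s vanishing clause, read on classes) has vanishing global class orbital integral at every class of `G_∞` projecting to such a class.
[cite: Arthur1988InvariantTraceFormulaII, §7] [cite: Rogawski1990, §3.1 p. 19] -/
theorem classOrbitalIntegral_archTensor_eq_zero_of_forall_place (hm : IsArchProductFamily H P m mloc)
    {f : ↥(arch (↥(maximalRealSubfield L)) L (IsCMField.complexConj L) N H) → ℂ} {φ : ∀ w : {w : InfinitePlace L // w.IsComplex}, ↥(archLocal L N H w) → ℂ}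
    (hf : ∀ g, f g = ∏ w, φ w (archPiEquivCM L H (N := N) g w)) (u : {w : InfinitePlace L // w.IsComplex})
    (Pu : ConjClasses ↥(archLocal L N H u) → Prop) (hφ : ∀ cu, Pu cu → classOrbitalIntegral (mloc u) (φ u) cu = 0)
    (γ : ↥(arch (↥(maximalRealSubfield L)) L (IsCMField.complexConj L) N H)) (hγ : P γ) (hc : Pu (ConjClasses.map (archProjAt H u) (ConjClasses.mk γ))) :
    classOrbitalIntegral m f (ConjClasses.mk γ) = 0 :=
  classOrbitalIntegral_archTensor_eq_zero_of_place H hm hf γ hγ u (hφ _ hc)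

end ArchProduct

end Summit.HodgeConjecture.HodgeConjecture.R90.S2

end
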